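import Literature.Probability.LatticeModels.PolymerPressure
import HarnessLib

/-!
# Subset polymers on the discrete cylinder/torus `ℤ_N × Y`: cyclic distance, time projection, short and time-connected sets (K47a)

HELPER toward stub **T1** `TwistedSlabAnchor` of LINE `twisted-slab-continuity` (crux `IRcof`,
stmt-QuantumFields-26930, census row 43; LEAD prover ym-ir-line-tsc-p1 g7; `--supports` the crux, `--as helper`):
brick **(m6)** of the M4 anatomy of memo `Cruxes/IRcof/T1-ANATOMY-tsc-p1.md` §16.3 — the TORUS FINITE-SIZE
bookkeeping of a Kotecký–Preiss polymer expansion of `log projSlabZ`, done model-free on the tree's PROVED KP layer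
(`Literature/Probability/LatticeModels/{ClusterExpansion, ClusterExpansionKPBound, PolymerPressure}`), so that an
eventual M4 line only has to produce the polymer representation ((m1)(m2)(m4)(m5)) and read off
`|log Ξ_{2t} − 2 log Ξ_t| ≤ A·t·L·e^{−ct}`. Nothing here is specific to gauge theory; T1 is NOT advanced by this file
alone (HONEST: T1 0∕1 = M4 + hcl; the Yang–Mills mass gap is NOT proved).

Geometry of the periodic "time" direction for gases of subset polymers on `X_N = ℤ_N × Y`
(`ZMod N × Y`; `Y` any type carrying everything that is not the periodic direction), the
vocabulary of the torus finite-size bookkeeping of the Kotecký–Preiss cluster expansion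
(K47b `…TorusCovering.lean`, K47c `…TorusDoubling.lean`; [KP86] p. 493, Borgs–Kotecký 1990 §1):

* `cycDist s t` — the cyclic distance on `ℤ_N` (via `ZMod.valMinAbs`; `cycDist_triangle`,
  `val_sub_sub_le_of_cycDist_le`). The same notion is defined as a `min` of forward distances in
  the RG barrier files (`Literature.Barriers.CriticalPhenomena.LongRangePhi4.Polymer.cycDist`,
  `RigorousRGSmallParameterTorusGeometry.lean`); it is re-defined here in `valMinAbs` form to keep
  the import closure small — a librarian may merge the two.
* `times S` — the time projection of `S ⊆ X_N`; `IsTimeShort ℓ S` — all times of `S` lie in an arc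
  of `ℓ` consecutive times (the polymers on which the activities of a torus and of its covers are
  required to agree); `IsTimeConnected r S` — the time projection cannot be split into two parts
  at cyclic distance `> r`.
* `cycDist_le_of_isTimeConnected` (ball growth), `le_of_not_isTimeShort` /
  `le_card_times_of_not_isTimeShort`: a non-empty time-connected set which is NOT `ℓ`-short has at
  least `ℓ/(2r)` distinct times — the entropy input that makes winding clusters small.
* `isTimeConnected_clusterSupp`: the support of a Kotecký–Preiss cluster (`IsPolymerCluster` for
  the meet-or-equal incompatibility `polyInc` of `PolymerPressure.lean`) of time-connected
  polymers is time-connected.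

Everything here is PROVED (elementary); 0 sorry.

## References

* [KP86] R. Kotecký, D. Preiss, Comm. Math. Phys. 103 (1986) 491–498, p. 493. [KoteckyPreiss1986]
* C. Borgs, R. Kotecký, J. Stat. Phys. 61 (1990) 79–119, §1. [BorgsKotecky1990]
-/

noncomputable section

open Finset
open scoped BigOperators
open Literature.Probability.LatticeModels

namespace Summit.QuantumFields.YangMills.Cruxes.IRcof.TwistedSlab

namespace PolymerTorus

/-! ### Cyclic distance on `ZMod N` -/

section CycDist

variable {N : ℕ}

/-- The cyclic (graph) distance on `ℤ_N`: `|t - s|` measured around the circle, i.e. the absolute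
value of the representative of `t - s` of least absolute value. [folklore] -/
def cycDist (s t : ZMod N) : ℕ := ((t - s).valMinAbs).natAbs

/-- The cyclic distance is bounded by the size of ANY integer representative of `t - s`. [folklore] -/
theorem cycDist_le_natAbs [NeZero N] {s t : ZMod N} {m : ℤ} (h : (m : ZMod N) = t - s) :
    cycDist s t ≤ m.natAbs :=
  ZMod.natAbs_min_of_le_div_two N _ _ (by rw [ZMod.coe_valMinAbs, h]) (ZMod.natAbs_valMinAbs_le _)

/-- `cycDist s s = 0`. [folklore] -/
theorem cycDist_self (s : ZMod N) : cycDist s s = 0 := by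
  simp [cycDist]

/-- `cycDist s t = 0 ↔ s = t`. [folklore] -/
theorem cycDist_eq_zero_iff {s t : ZMod N} : cycDist s t = 0 ↔ s = t := by
  unfold cycDist
  rw [Int.natAbs_eq_zero, ZMod.valMinAbs_eq_zero, sub_eq_zero]
  exact eq_comm

/-- Symmetry of the cyclic distance. [folklore] -/
theorem cycDist_comm (s t : ZMod N) : cycDist s t = cycDist t s := by
  unfold cycDist
  rw [← neg_sub t s, ZMod.natAbs_valMinAbs_neg]

/-- Triangle inequality for the cyclic distance. [folklore] -/
theorem cycDist_triangle [NeZero N] (s t u : ZMod N) : cycDist s u ≤ cycDist s t + cycDist t u := by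
  refine (cycDist_le_natAbs (m := (t - s).valMinAbs + (u - t).valMinAbs) ?_).trans
    (Int.natAbs_add_le _ _)
  push_cast
  abel

/-- A point at cyclic distance `≤ R` from `t₀` lies in the arc of `2R + 1` consecutive times
starting at `t₀ - R`: `(t - (t₀ - R)).val ≤ 2R`. [folklore] -/
theorem val_sub_sub_le_of_cycDist_le {t₀ t : ZMod N} {R : ℕ} (h : cycDist t₀ t ≤ R) :
    (t - (t₀ - (R : ZMod N))).val ≤ 2 * R := by
  have hm : ((t - t₀).valMinAbs : ZMod N) = t - t₀ := ZMod.coe_valMinAbs _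
  have habs : ((t - t₀).valMinAbs).natAbs ≤ R := h
  set m : ℤ := (t - t₀).valMinAbs with hm_def
  have h0 : 0 ≤ m + R := by omega
  have h2 : m + R ≤ 2 * R := by omega
  have hrew : t - (t₀ - (R : ZMod N)) = (((m + R).toNat : ℕ) : ZMod N) := by
    have : (((m + R).toNat : ℕ) : ZMod N) = ((m + R : ℤ) : ZMod N) := by
      rw [← Int.toNat_of_nonneg h0]
      push_cast
      rw [Int.toNat_of_nonneg h0]
    rw [this]
    push_cast
    rw [hm]
    ring
  rw [hrew, ZMod.val_natCast]
  refine (Nat.mod_le _ _).trans ?_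
  have : ((m + R).toNat : ℤ) ≤ 2 * R := by rw [Int.toNat_of_nonneg h0]; exact h2
  exact_mod_cast this

end CycDist

/-! ### Time projection of subset polymers on `ℤ_N × Y`; short and time-connected sets -/

section Time

variable {N : ℕ} {Y : Type*}

/-- The time projection `{t : (t, y) ∈ S}` of a set of sites of `ℤ_N × Y`. [folklore] -/
def times (S : Finset (ZMod N × Y)) : Finset (ZMod N) := S.image Prod.fst

/-- Membership in the time projection. [folklore] -/
theorem mem_times {S : Finset (ZMod N × Y)} {t : ZMod N} : t ∈ times S ↔ ∃ x ∈ S, x.1 = t :=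
  Finset.mem_image

/-- The time of a site of `S` belongs to `times S`. [folklore] -/
theorem fst_mem_times {S : Finset (ZMod N × Y)} {x : ZMod N × Y} (hx : x ∈ S) : x.1 ∈ times S :=
  Finset.mem_image_of_mem _ hx

/-- `times` is monotone. [folklore] -/
theorem times_mono {S S' : Finset (ZMod N × Y)} (h : S ⊆ S') : times S ⊆ times S' :=
  Finset.image_subset_image h

/-- `|times S| ≤ |S|`. [folklore] -/
theorem card_times_le (S : Finset (ZMod N × Y)) : (times S).card ≤ S.card :=
  Finset.card_image_le

/-- `S` is **`ℓ`-short**: all its times lie in an arc `{a, a + 1, …, a + ℓ - 1}` of `ℓ`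
consecutive times (for `ℓ ≤ N` these are `ℓ` distinct times). These are the polymers on which
the activities of a torus and of its covers are required to agree. [folklore] -/
def IsTimeShort (ℓ : ℕ) (S : Finset (ZMod N × Y)) : Prop :=
  ∃ a : ZMod N, ∀ x ∈ S, (x.1 - a).val < ℓ

/-- Subsets of short sets are short. [folklore] -/
theorem IsTimeShort.mono {ℓ : ℕ} {S S' : Finset (ZMod N × Y)} (h : IsTimeShort ℓ S') (hS : S ⊆ S') :
    IsTimeShort ℓ S := by
  obtain ⟨a, ha⟩ := h
  exact ⟨a, fun x hx => ha x (hS hx)⟩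

/-- The empty set is short. [folklore] -/
theorem isTimeShort_empty [NeZero N] (ℓ : ℕ) : IsTimeShort ℓ (∅ : Finset (ZMod N × Y)) :=
  ⟨0, fun _ hx => (Finset.notMem_empty _ hx).elim⟩

/-- A set which is not short has non-empty support. [folklore] -/
theorem nonempty_of_not_isTimeShort [NeZero N] {ℓ : ℕ} {S : Finset (ZMod N × Y)}
    (h : ¬ IsTimeShort ℓ S) : S.Nonempty := by
  rw [Finset.nonempty_iff_ne_empty]
  rintro rfl
  exact h (isTimeShort_empty ℓ)

/-- A set all of whose times are within cyclic distance `R` of one time `t₀`, with `2R + 1 ≤ ℓ`,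
is `ℓ`-short. [folklore] -/
theorem isTimeShort_of_forall_cycDist_le {ℓ R : ℕ} {S : Finset (ZMod N × Y)} {t₀ : ZMod N}
    (h : ∀ x ∈ S, cycDist t₀ x.1 ≤ R) (hR : 2 * R + 1 ≤ ℓ) : IsTimeShort ℓ S :=
  ⟨t₀ - (R : ZMod N), fun x hx => lt_of_le_of_lt (val_sub_sub_le_of_cycDist_le (h x hx)) (by omega)⟩

/-- `S` is **time-connected at range `r`**: its time projection cannot be split into two
non-empty parts at mutual cyclic distance `> r` (for `r = 1`: the times of `S` form a cyclic
interval). [folklore] -/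
def IsTimeConnected (r : ℕ) (S : Finset (ZMod N × Y)) : Prop :=
  ∀ T₁ ⊆ times S, T₁.Nonempty → (times S \ T₁).Nonempty →
    ∃ s ∈ T₁, ∃ t ∈ times S \ T₁, cycDist s t ≤ r

/-- **Ball growth in a time-connected set**: every time of a time-connected `S` is within cyclic
distance `(|times S| - 1) · r` of any fixed time `t₀` of `S` (the ball of radius `j r` around `t₀`
inside `times S` has at least `j + 1` elements until it exhausts `times S`). [folklore] -/
theorem cycDist_le_of_isTimeConnected [NeZero N] {r : ℕ} {S : Finset (ZMod N × Y)}
    (hS : IsTimeConnected r S) {t₀ : ZMod N} (ht₀ : t₀ ∈ times S) {t : ZMod N} (ht : t ∈ times S) :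
    cycDist t₀ t ≤ ((times S).card - 1) * r := by
  classical
  -- `B j` = the times of `S` within distance `j r` of `t₀`
  set B : ℕ → Finset (ZMod N) := fun j => (times S).filter fun s => cycDist t₀ s ≤ j * r with hB
  have hBsub : ∀ j, B j ⊆ times S := fun j => Finset.filter_subset _ _
  have ht₀B : ∀ j, t₀ ∈ B j := fun j =>
    Finset.mem_filter.2 ⟨ht₀, by rw [cycDist_self]; exact Nat.zero_le _⟩
  have hmonoB : ∀ j, B j ⊆ B (j + 1) := fun j s hs => by
    obtain ⟨hs1, hs2⟩ := Finset.mem_filter.1 hs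
    exact Finset.mem_filter.2 ⟨hs1, hs2.trans (Nat.mul_le_mul_right _ (Nat.le_succ j))⟩
  -- growth: either `B j` is everything or it has at least `j + 1` elements
  have hgrow : ∀ j, B j = times S ∨ j + 1 ≤ (B j).card := by
    intro j
    induction j with
    | zero => exact Or.inr (Finset.card_pos.2 ⟨t₀, ht₀B 0⟩)
    | succ j ih =>
      by_cases hall : B j = times S
      · exact Or.inl (Finset.Subset.antisymm (hBsub _) (hall ▸ hmonoB j))
      · right
        have hcard : j + 1 ≤ (B j).card := ih.resolve_left hall
        have hne : (times S \ B j).Nonempty := by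
          rw [Finset.sdiff_nonempty]
          exact fun hsub => hall (Finset.Subset.antisymm (hBsub j) hsub)
        obtain ⟨s, hs, u, hu, hsu⟩ := hS (B j) (hBsub j) ⟨t₀, ht₀B j⟩ hne
        obtain ⟨huS, huB⟩ := Finset.mem_sdiff.1 hu
        have hsd : cycDist t₀ s ≤ j * r := (Finset.mem_filter.1 hs).2
        have huB' : u ∈ B (j + 1) := by
          refine Finset.mem_filter.2 ⟨huS, ?_⟩
          calc cycDist t₀ u ≤ cycDist t₀ s + cycDist s u := cycDist_triangle _ _ _
            _ ≤ j * r + r := Nat.add_le_add hsd hsu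
            _ = (j + 1) * r := by ring
        have hssub : insert u (B j) ⊆ B (j + 1) := Finset.insert_subset huB' (hmonoB j)
        calc j + 1 + 1 ≤ (B j).card + 1 := Nat.add_le_add_right hcard 1
          _ = (insert u (B j)).card := (Finset.card_insert_of_notMem huB).symm
          _ ≤ (B (j + 1)).card := Finset.card_le_card hssub
  -- at `j = |times S| - 1` the ball is everything
  have hfull : B ((times S).card - 1) = times S := by
    rcases hgrow ((times S).card - 1) with h | h
    · exact h
    · refine Finset.eq_of_subset_of_card_le (hBsub _) ?_
      have hpos : 0 < (times S).card := Finset.card_pos.2 ⟨t₀, ht₀⟩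
      omega
  have htB : t ∈ B ((times S).card - 1) := hfull.symm ▸ ht
  exact (Finset.mem_filter.1 htB).2

/-- **Long time-connected sets have many times**: if `S` is non-empty, time-connected at range
`r` and NOT `ℓ`-short, then `ℓ ≤ 2 r (|times S| - 1)`. [folklore] -/
theorem le_of_not_isTimeShort [NeZero N] {ℓ r : ℕ} {S : Finset (ZMod N × Y)}
    (hS : IsTimeConnected r S) (hne : S.Nonempty) (hlong : ¬ IsTimeShort ℓ S) :
    ℓ ≤ 2 * r * ((times S).card - 1) := by
  by_contra hlt
  push Not at hlt
  obtain ⟨x₀, hx₀⟩ := hne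
  refine hlong (isTimeShort_of_forall_cycDist_le (R := ((times S).card - 1) * r) (t₀ := x₀.1)
    (fun x hx => cycDist_le_of_isTimeConnected hS (fst_mem_times hx₀) (fst_mem_times hx)) ?_)
  rw [mul_comm ((times S).card - 1) r, ← mul_assoc]
  omega

/-- Real form: a non-empty, time-connected, not `ℓ`-short set has at least `ℓ/(2r)` distinct times
(and in particular at least `ℓ/(2r)` sites). [folklore] -/
theorem le_card_times_of_not_isTimeShort [NeZero N] {ℓ r : ℕ} {S : Finset (ZMod N × Y)}
    (hS : IsTimeConnected r S) (hne : S.Nonempty) (hlong : ¬ IsTimeShort ℓ S) :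
    (ℓ : ℝ) / (2 * r) ≤ (times S).card := by
  have h := le_of_not_isTimeShort hS hne hlong
  obtain ⟨x₀, hx₀⟩ := hne
  have hpos : 0 < (times S).card := Finset.card_pos.2 ⟨_, fst_mem_times hx₀⟩
  rcases Nat.eq_zero_or_pos r with hr | hr
  · subst hr
    simp
  · rw [div_le_iff₀ (by positivity)]
    have h' : (ℓ : ℝ) ≤ 2 * r * ((times S).card - 1 : ℕ) := by exact_mod_cast h
    have hc : (((times S).card - 1 : ℕ) : ℝ) = (times S).card - 1 := by
      rw [Nat.cast_sub hpos, Nat.cast_one]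
    rw [hc] at h'
    nlinarith [(Nat.cast_nonneg r : (0 : ℝ) ≤ r)]

/-- **Supports of clusters of time-connected polymers are time-connected**: if `C` is a cluster
for the meet-or-equal incompatibility `polyInc` and every member of `C` is time-connected at
range `r`, so is `clusterSupp C` (two incompatible subset polymers share a site, hence a time).
[folklore] -/
theorem isTimeConnected_clusterSupp [DecidableEq Y] {r : ℕ} {C : Finset (Finset (ZMod N × Y))}
    (hCl : IsPolymerCluster polyInc C) (hconn : ∀ A ∈ C, IsTimeConnected r A) :
    IsTimeConnected r (clusterSupp C) := by
  classical
  intro T₁ hT₁ hT₁ne hT₂ne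
  by_contra hfar
  push Not at hfar
  -- every member has its times inside `T₁` or disjoint from `T₁`
  have hdich : ∀ A ∈ C, times A ⊆ T₁ ∨ Disjoint (times A) T₁ := by
    intro A hA
    by_contra hnot
    push Not at hnot
    obtain ⟨hnsub, hndisj⟩ := hnot
    have hAT : times A ⊆ times (clusterSupp C) := times_mono (subset_clusterSupp hA)
    have h1 : (times A ∩ T₁).Nonempty := by
      rw [Finset.not_disjoint_iff_nonempty_inter] at hndisj
      exact hndisj
    have h2 : (times A \ (times A ∩ T₁)).Nonempty := by
      rw [Finset.sdiff_nonempty]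
      intro hsub
      exact hnsub fun s hs => (Finset.mem_inter.1 (hsub hs)).2
    obtain ⟨s, hs, t, ht, hst⟩ := hconn A hA (times A ∩ T₁) Finset.inter_subset_left h1 h2
    obtain ⟨htA, htn⟩ := Finset.mem_sdiff.1 ht
    have htT₁ : t ∉ T₁ := fun h => htn (Finset.mem_inter.2 ⟨htA, h⟩)
    exact absurd hst (not_le.2 (hfar s (Finset.mem_inter.1 hs).2 t
      (Finset.mem_sdiff.2 ⟨hAT htA, htT₁⟩)))
  set C₁ : Finset (Finset (ZMod N × Y)) := C.filter fun A => times A ⊆ T₁ with hC₁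
  have hC₁ne : C₁.Nonempty := by
    obtain ⟨s, hs⟩ := hT₁ne
    obtain ⟨x, hx, rfl⟩ := mem_times.1 (hT₁ hs)
    obtain ⟨A, hA, hxA⟩ := mem_clusterSupp.1 hx
    refine ⟨A, Finset.mem_filter.2 ⟨hA, (hdich A hA).resolve_right fun hdis => ?_⟩⟩
    exact Finset.disjoint_left.1 hdis (fst_mem_times hxA) hs
  have hC₂ne : (C \ C₁).Nonempty := by
    obtain ⟨t, ht⟩ := hT₂ne
    obtain ⟨htS, htT₁⟩ := Finset.mem_sdiff.1 ht
    obtain ⟨x, hx, rfl⟩ := mem_times.1 htS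
    obtain ⟨A, hA, hxA⟩ := mem_clusterSupp.1 hx
    exact ⟨A, Finset.mem_sdiff.2 ⟨hA, fun hA₁ => htT₁ ((Finset.mem_filter.1 hA₁).2 (fst_mem_times hxA))⟩⟩
  obtain ⟨γ₁, hγ₁, γ₂, hγ₂, hinc⟩ := hCl C₁ (Finset.filter_subset _ _) hC₁ne hC₂ne
  obtain ⟨hγ₂C, hγ₂C₁⟩ := Finset.mem_sdiff.1 hγ₂
  have hγ₁T : times γ₁ ⊆ T₁ := (Finset.mem_filter.1 hγ₁).2
  have hγ₂T : Disjoint (times γ₂) T₁ :=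
    (hdich γ₂ hγ₂C).resolve_left fun hsub => hγ₂C₁ (Finset.mem_filter.2 ⟨hγ₂C, hsub⟩)
  rcases hinc with hEq | ⟨x, hx⟩
  · exact hγ₂C₁ (hEq ▸ hγ₁)
  · obtain ⟨hx₁, hx₂⟩ := Finset.mem_inter.1 hx
    exact Finset.disjoint_left.1 hγ₂T (fst_mem_times hx₂) (hγ₁T (fst_mem_times hx₁))

end Time

end PolymerTorus

end Summit.QuantumFields.YangMills.Cruxes.IRcof.TwistedSlab
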